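/-
Origin: expansion seat `prover-pub-hodgecm-mc-carch-1-g36-0`, handover #CA63 2026-08-21T00:38Z md5 dfffa43b0481 (320 l.; NEW additive leaf; imports Model.HypCensus.LetterSection + Vendored…SegalBargmann.FockInvariantLines; ns HodgeCM.Model.MultOne; 10 theorems 2 defs; NAMES for audit: HodgeCM.Model.MultOne.exists_eq_smul_hermitePi_of_torusStable · HodgeCM.Model.MultOne.cmLetterBlock_torusLetter · HodgeCM.Model.MultOne.exists_eq_smul_of_torusLetter_eigen) (`HOME/mc/pub-hodgecm-mc-carch-1/stage68/HodgeCM/Model/ArchKTypeOfMultOneTorus.lean`, md5 dfffa43b0481, 320 lines);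
landed by the second packager p2 gen 16 (p2-g16) in gate run 68 as `HodgeCM/Model/ArchKTypeOfMultOneTorus.lean` (verbatim).
-/
/-
Copyright (c) 2026 the pub-hodgecm formalisation cell (harness21).  New file, not vendored.
Origin: session prover-pub-hodgecm-mc-carch-1-g36-0 (unit pub-hodgecm-mc-carch-1, C / ARCHDATUM BUILDER gen 36; the (J4-mult1)
input of the (J-Liu-Θ) junction behind E's row 9 `hΘ` — multiplicity at most one of the archimedean `K_∞`-type of a slot — PROVED
in the kernel for the honest line representations), 2026-08-21.
Intended final place: `HodgeCM/Model/ArchKTypeOfMultOneTorus.lean` (NEW additive model-layer leaf, part 1 of 2: the generic torus engine;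
imported by `HodgeCM/Model/ArchKTypeOfMultOne.lean` only).
-/
import Summits.HodgeConjecture.HodgeCM.Model.HypCensus.LetterSection
import Literature.Analysis.SegalBargmann.FockInvariantLines

set_option autoImplicit false

/-!
# (J4-mult1) in the kernel, part 1: torus eigenvectors of the oscillator representation and the torus letters of a line pin

Cell pub-hodgecm, MODEL layer (construction prover mc-carch-1, gen 36).  Generic half of `Model/ArchKTypeOfMultOne` (see the module
docstring there for the whole argument and its use at row 9):

* § 0 (`𝓢(ℝ^σ)`): `μ₀(diag t) h_α = torusChar α t • h_α`; torus characters are pairwise distinct (`eq_of_torusChar_eq`); a simultaneous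
  torus eigenvector in `𝓢(ℝ^σ)` is a multiple of ONE Hermite function (`exists_eq_smul_hermitePi_of_torusStable`, the tree's
  `FockInvariantLines.exists_eq_smul_fockBasis_of_torusStable_line` through `toL2` and the Bargmann unitary); two Schwartz functions with the
  same torus eigenvalue function are proportional (`exists_eq_smul_of_torusEigen`).
* § 1 (CM pin, any ranks): the compact-letter ENGINE at OPERATOR level, `ω_∞(letterSection h) f = χ h • 𝔢*⁻¹ (μ₀(cmLetterBlock h) (𝔢* f))`
  for ONE continuous character `χ` of `Π_v DPK_v` (`exists_character_letterSection_apply`; tree `IsArchWeilDatum.exists_eq_compactWeilRep`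
  on binder-2's `isArchWeilDatum_repTransport_cmArchWeilRep_of_signs` along the generic `letterSection`, as `DenseArch` § 1).
* § 2 (`M = 1`): the torus letters `torusLetter t` of a LINE pin have letter block `diagHom t` for every `t` (`cmLetterBlock_torusLetter`).
* § 3 CORE `exists_eq_smul_of_torusLetter_eigen`: joint eigenvectors of all torus letters with the same eigenvalue function are proportional.

KERNEL only: 0 records, 0 `def … : Prop`, nothing cited as a hypothesis; data defs `torusLetterV`, `torusLetter`.  Two
`set_option maxHeartbeats 400000 in` on statements whose elaboration unifies the pin's group types (as binder-2's `DenseArch` § 1).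
[Folland 1989, §1.7 (vii), Prop. (4.39), Prop. (4.76) — dictionary only.]
-/

noncomputable section

open NumberField NumberField.InfinitePlace NumberField.mixedEmbedding IsDedekindDomain MeasureTheory
open scoped Matrix TensorProduct Classical SchwartzMap ComplexConjugate
open Literature.NumberTheory.Automorphic Literature.NumberTheory.Weil1964
open Literature.RepresentationTheory.KonnoKonno2007 Literature.RepresentationTheory.KonnoKonno2007.RealDualPair
open Literature.NumberTheory.GelbartRogawski1991 Literature.NumberTheory.GelbartRogawski1991.UnitaryDualPair
open Literature.Analysis.SegalBargmann

namespace HodgeCM.Model.MultOne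

/-! ## § 0. Torus eigenvectors of the Schrödinger model are Hermite functions (Folland 1989 §1.7, Prop. (4.76)) -/

section Torus

variable {σ : Type*} [Fintype σ] [DecidableEq σ]

/-- The diagonal torus on a Hermite function: `μ₀(diag t) h_α = torusChar α t • h_α`. -/
theorem unitaryOpPi_diagHom_hermitePi (t : σ → Circle) (α : σ →₀ ℕ) :
    unitaryOpPi (diagHom t) (hermitePi α) = Literature.Analysis.SegalBargmann.torusChar α t • hermitePi α := by
  rw [← torusPt_torusAngle t, unitaryOpPi_diagHom_torusPt, torusOpPi_hermitePi, torusChar_torusPt]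

/-- The torus characters of distinct multi-indices are distinct functions on the torus. -/
theorem eq_of_torusChar_eq {α β : σ →₀ ℕ}
    (h : ∀ t : σ → Circle, Literature.Analysis.SegalBargmann.torusChar α t = Literature.Analysis.SegalBargmann.torusChar β t) :
    α = β := by
  by_contra hne
  obtain ⟨l, hl⟩ := Finsupp.ne_iff.mp hne
  set N : ℕ := max (α l) (β l) + 1 with hN
  have hN0 : N ≠ 0 := by omega
  have hprim : IsPrimitiveRoot (Complex.exp (2 * Real.pi * Complex.I / N)) N := Complex.isPrimitiveRoot_exp N hN0
  have hh := h (torusProbe l N)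
  rw [torusChar_torusProbe, torusChar_torusProbe] at hh
  exact hl (hprim.pow_inj (by omega) (by omega) hh)

/-- **A simultaneous eigenvector of the diagonal torus in `𝓢(ℝ^σ)` is a multiple of ONE Hermite function.** -/
theorem exists_eq_smul_hermitePi_of_torusStable {f : 𝓢((σ → ℝ), ℂ)} (hf : f ≠ 0)
    (h : ∀ t : σ → Circle, unitaryOpPi (diagHom t) f ∈ ℂ ∙ f) :
    ∃ (α : σ →₀ ℕ) (a : ℂ), a ≠ 0 ∧ f = a • hermitePi α := by
  have hv : bargmann (toL2 f) ≠ 0 := fun h0 =>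
    hf (toL2_injective (by rw [(LinearIsometryEquiv.map_eq_zero_iff _).mp h0, map_zero]))
  have hst : ∀ t : σ → Circle, fockRep (diagHom t) (bargmann (toL2 f)) ∈ ℂ ∙ bargmann (toL2 f) := by
    intro t
    obtain ⟨μ, hμ⟩ := Submodule.mem_span_singleton.mp (h t)
    refine Submodule.mem_span_singleton.mpr ⟨μ, ?_⟩
    have h1 := congrArg (fun g => bargmann (toL2 g)) hμ
    simp only [map_smul, toL2_unitaryOpPi, schrodingerU_apply, LinearIsometryEquiv.apply_symm_apply] at h1
    exact h1
  obtain ⟨α, a, ha, hα⟩ := exists_eq_smul_fockBasis_of_torusStable_line hv hst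
  refine ⟨α, a, ha, toL2_injective (bargmann.injective ?_)⟩
  rw [hα, map_smul, LinearIsometryEquiv.map_smul, toL2_hermitePi, bargmann_hermiteL2, fockBasis_apply]

/-- **Joint torus eigenspaces of `𝓢(ℝ^σ)` are at most one-dimensional.**  Along any family `T : S → (σ → S¹)` ONTO the
torus and nonvanishing scalars `z`, two Schwartz functions with `z s • μ₀(diag (T s)) f = c s • f` for the SAME
eigenvalue function `c` are proportional. -/
theorem exists_eq_smul_of_torusEigen {S : Type*} (T : S → (σ → Circle)) (hT : Function.Surjective T) (z c : S → ℂ)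
    (hz : ∀ s, z s ≠ 0) {f g : 𝓢((σ → ℝ), ℂ)} (hf0 : f ≠ 0)
    (hf : ∀ s, z s • unitaryOpPi (diagHom (T s)) f = c s • f) (hg : ∀ s, z s • unitaryOpPi (diagHom (T s)) g = c s • g) :
    ∃ r : ℂ, g = r • f := by
  by_cases hg0 : g = 0
  · exact ⟨0, by rw [hg0, zero_smul]⟩
  have stable : ∀ {u : 𝓢((σ → ℝ), ℂ)}, (∀ s, z s • unitaryOpPi (diagHom (T s)) u = c s • u) →
      ∀ t : σ → Circle, unitaryOpPi (diagHom t) u ∈ ℂ ∙ u := by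
    intro u hu t
    obtain ⟨s, rfl⟩ := hT t
    refine Submodule.mem_span_singleton.mpr ⟨(z s)⁻¹ * c s, ?_⟩
    rw [← smul_smul, ← hu s, smul_smul, inv_mul_cancel₀ (hz s), one_smul]
  obtain ⟨α, a, ha, hfa⟩ := exists_eq_smul_hermitePi_of_torusStable hf0 (stable hf)
  obtain ⟨β, b, hb, hgb⟩ := exists_eq_smul_hermitePi_of_torusStable hg0 (stable hg)
  -- the eigenvalue functions force `α = β`
  have hc : ∀ s, c s = z s * Literature.Analysis.SegalBargmann.torusChar α (T s) := by
    intro s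
    have h1 := hf s
    rw [hfa, map_smul, unitaryOpPi_diagHom_hermitePi, smul_smul, smul_smul, smul_smul] at h1
    have hne : (hermitePi α : 𝓢((σ → ℝ), ℂ)) ≠ 0 := fun h0 => hf0 (by rw [hfa, h0, smul_zero])
    have := smul_left_injective ℂ hne h1
    have key : c s * a = (z s * Literature.Analysis.SegalBargmann.torusChar α (T s)) * a := by rw [← this]; ring
    exact mul_right_cancel₀ ha key
  have hc' : ∀ s, c s = z s * Literature.Analysis.SegalBargmann.torusChar β (T s) := by
    intro s
    have h1 := hg s
    rw [hgb, map_smul, unitaryOpPi_diagHom_hermitePi, smul_smul, smul_smul, smul_smul] at h1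
    have hne : (hermitePi β : 𝓢((σ → ℝ), ℂ)) ≠ 0 := fun h0 => hg0 (by rw [hgb, h0, smul_zero])
    have := smul_left_injective ℂ hne h1
    have key : c s * b = (z s * Literature.Analysis.SegalBargmann.torusChar β (T s)) * b := by rw [← this]; ring
    exact mul_right_cancel₀ hb key
  have hαβ : α = β := by
    refine eq_of_torusChar_eq fun t => ?_
    obtain ⟨s, rfl⟩ := hT t
    exact mul_left_cancel₀ (hz s) ((hc s).symm.trans (hc' s))
  refine ⟨b * a⁻¹, ?_⟩
  rw [hgb, hfa, hαβ, smul_smul, mul_assoc, inv_mul_cancel₀ ha, mul_one]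

end Torus


/-! ## § 1. The compact-letter engine of the CM pin at OPERATOR level (any ranks `N, M`) -/

section Engine

open HodgeCM.Model.HypCensus

variable (L : Type) [Field L] [NumberField L] [IsCMField L] {N M n : ℕ} (e : Fin N × Fin M ≃ Fin n)
variable (dV : Fin N → L) (hdV : ∀ i, IsCMField.complexConj L (dV i) = dV i) (hdV0 : ∀ i, dV i ≠ 0)
variable (dW : Fin M → L) (hdW : ∀ i, IsCMField.complexConj L (dW i) = dW i) (hdW0 : ∀ i, dW i ≠ 0)
variable (hGR : (cmSplittingDatum L e dV hdV hdV0 dW hdW hdW0).CompatibleSplitting) (ι₁ : L →+* ℂ)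

set_option maxHeartbeats 400000 in
/-- **ENGINE (operator level).**  Under the four sign facts of the pin there is ONE continuous unitary character `χ` of
the universal letter group `Π_v DPK_v` such that, for EVERY letter tuple `h` and EVERY Schwartz function `f`,
`ω_∞(letterSection h) f = χ h • 𝔢*⁻¹ (μ₀(cmLetterBlock h) (𝔢* f))`, `𝔢 = cmBigFrame` (tree
`IsArchWeilDatum.exists_eq_compactWeilRep`, Folland 1989 Prop. (4.39), on binder-2's datum
`isArchWeilDatum_repTransport_cmArchWeilRep_of_signs` along the generic `letterSection`). -/
theorem exists_character_letterSection_apply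
    (h₁V : ∃ i₀ : Fin N, (∀ i, i ≠ i₀ → 0 < (ι₁ (dV i)).re) ∨ ∀ i, i ≠ i₀ → (ι₁ (dV i)).re < 0)
    (h₁W : (∀ j, 0 < (ι₁ (dW j)).re) ∨ ∀ j, (ι₁ (dW j)).re < 0)
    (hV : ∀ τ : L →+* ℂ, InfinitePlace.mk τ ≠ InfinitePlace.mk ι₁ → (∀ i, 0 < (τ (dV i)).re) ∨ ∀ i, (τ (dV i)).re < 0)
    (hW : ∀ τ : L →+* ℂ, InfinitePlace.mk τ ≠ InfinitePlace.mk ι₁ →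
      (∃ j₀ : Fin M, ∀ j, j ≠ j₀ → 0 < (τ (dW j)).re) ∨ ∀ j, (τ (dW j)).re < 0) :
    ∃ χ : (∀ v : {v : InfinitePlace ↥(maximalRealSubfield L) // v.IsReal},
        DPK (PosIdx (cmXV L dV hdV ι₁ v)) (NegIdx (cmXV L dV hdV ι₁ v)) (PosIdx (cmXW L dV dW hdW ι₁ v))
          (NegIdx (cmXW L dV dW hdW ι₁ v))) →* Circle,
      ∀ (h : ∀ v : {v : InfinitePlace ↥(maximalRealSubfield L) // v.IsReal},
          DPK (PosIdx (cmXV L dV hdV ι₁ v)) (NegIdx (cmXV L dV hdV ι₁ v)) (PosIdx (cmXW L dV dW hdW ι₁ v))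
            (NegIdx (cmXW L dV dW hdW ι₁ v)))
        (f : 𝓢((Fin n → mixedSpace (↥(maximalRealSubfield L))), ℂ)),
        cmArchWeilRep L e dV hdV hdV0 dW hdW hdW0 hGR (letterSection L dV hdV hdV0 dW hdW hdW0 ι₁ h) f =
          ((χ h : Circle) : ℂ) •
            (schwartzTransport (cmBigFrame L e dV hdV hdV0 dW hdW hdW0 ι₁)).symm
              (unitaryOpPi (cmLetterBlock L e dV hdV dW hdW ι₁ (fun v => Pi.evalMonoidHom _ v) h)
                (schwartzTransport (cmBigFrame L e dV hdV hdV0 dW hdW hdW0 ι₁) f)) := by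
  have hWD := isArchWeilDatum_repTransport_cmArchWeilRep_of_signs L e dV hdV hdV0 dW hdW hdW0 hGR ι₁ h₁V h₁W hV hW
  obtain ⟨χ, -, hχ⟩ := hWD.exists_eq_compactWeilRep (letterSection L dV hdV hdV0 dW hdW hdW0 ι₁)
    (continuous_letterSection L dV hdV hdV0 dW hdW hdW0 ι₁)
    (cmLetterBlock L e dV hdV dW hdW ι₁ (fun v => Pi.evalMonoidHom _ v))
    (cmArchPairPhaseHom_eq_realifySp_of_components L e dV hdV hdV0 dW hdW hdW0 ι₁
      (letterSection L dV hdV hdV0 dW hdW hdW0 ι₁) (fun v => Pi.evalMonoidHom _ v)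
      (cmPlaceComponent_letterSection L dV hdV hdV0 dW hdW hdW0 ι₁))
  refine ⟨χ, fun h f => ?_⟩
  have h3 := hχ h (schwartzTransport (cmBigFrame L e dV hdV hdV0 dW hdW hdW0 ι₁) f)
  rw [repTransport_apply, ContinuousLinearEquiv.symm_apply_apply, compactWeilRep_apply] at h3
  have h4 := congrArg (schwartzTransport (cmBigFrame L e dV hdV hdV0 dW hdW hdW0 ι₁)).symm h3
  rw [ContinuousLinearEquiv.symm_apply_apply, map_smul] at h4
  exact h4

end Engine

/-! ## § 2. The torus letters of a LINE pin (`M = 1`) exhaust the diagonal torus of the big frame -/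

section TorusLetters

open HodgeCM.Model.HypCensus

variable (L : Type) [Field L] [NumberField L] [IsCMField L] {N n : ℕ} (e : Fin N × Fin 1 ≃ Fin n)
variable (dV : Fin N → L) (hdV : ∀ i, IsCMField.complexConj L (dV i) = dV i) (hdV0 : ∀ i, dV i ≠ 0)
variable (dW : Fin 1 → L) (hdW : ∀ i, IsCMField.complexConj L (dW i) = dW i) (hdW0 : ∀ i, dW i ≠ 0)
variable (ι₁ : L →+* ℂ)

/-- The `V`-letter at the real place `v` of the torus letter with big-frame eigenvalues `t`: diagonal on `V⁺_v` and on
`V⁻_v`, with the entry at the coordinate `i = e (j, 0)` equal to `t (i, v)` or its inverse according to the signs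
(same-sign blocks of Konno–Konno's `dualPairι` are conjugated). -/
def torusLetterV (t : Fin n × {v : InfinitePlace ↥(maximalRealSubfield L) // v.IsReal} → Circle)
    (v : {v : InfinitePlace ↥(maximalRealSubfield L) // v.IsReal}) :
    Matrix.unitaryGroup (PosIdx (cmXV L dV hdV ι₁ v)) ℂ × Matrix.unitaryGroup (NegIdx (cmXV L dV hdV ι₁ v)) ℂ :=
  (diagHom fun p => if 0 < cmXW L dV dW hdW ι₁ v 0 then (t (e (p.1, 0), v))⁻¹ else t (e (p.1, 0), v),
   diagHom fun q => if 0 < cmXW L dV dW hdW ι₁ v 0 then t (e (q.1, 0), v) else (t (e (q.1, 0), v))⁻¹)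

/-- The torus letter tuple with big-frame eigenvalues `t` (trivial `W`-letters). -/
def torusLetter (t : Fin n × {v : InfinitePlace ↥(maximalRealSubfield L) // v.IsReal} → Circle) :
    ∀ v : {v : InfinitePlace ↥(maximalRealSubfield L) // v.IsReal},
      DPK (PosIdx (cmXV L dV hdV ι₁ v)) (NegIdx (cmXV L dV hdV ι₁ v)) (PosIdx (cmXW L dV dW hdW ι₁ v))
        (NegIdx (cmXW L dV dW hdW ι₁ v)) :=
  fun v => (torusLetterV L e dV hdV dW hdW ι₁ t v, 1)

/-- (Ported verbatim from the HodgeCMPerL package; no docstring in the source.) -/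
theorem torusLetter_apply (t : Fin n × {v : InfinitePlace ↥(maximalRealSubfield L) // v.IsReal} → Circle)
    (v : {v : InfinitePlace ↥(maximalRealSubfield L) // v.IsReal}) :
    torusLetter L e dV hdV dW hdW ι₁ t v = (torusLetterV L e dV hdV dW hdW ι₁ t v, 1) := rfl

/-- (Ported verbatim from the HodgeCMPerL package; no docstring in the source.) -/
@[simp] theorem torusLetter_apply_fst (t : Fin n × {v : InfinitePlace ↥(maximalRealSubfield L) // v.IsReal} → Circle)
    (v : {v : InfinitePlace ↥(maximalRealSubfield L) // v.IsReal}) :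
    (torusLetter L e dV hdV dW hdW ι₁ t v).1 = torusLetterV L e dV hdV dW hdW ι₁ t v := rfl

/-- (Ported verbatim from the HodgeCMPerL package; no docstring in the source.) -/
@[simp] theorem torusLetter_apply_snd (t : Fin n × {v : InfinitePlace ↥(maximalRealSubfield L) // v.IsReal} → Circle)
    (v : {v : InfinitePlace ↥(maximalRealSubfield L) // v.IsReal}) :
    (torusLetter L e dV hdV dW hdW ι₁ t v).2 = 1 := rfl

/-- **The letter block of a torus letter is the diagonal torus element `diag t` of the big frame.** -/
theorem cmLetterBlock_torusLetter (t : Fin n × {v : InfinitePlace ↥(maximalRealSubfield L) // v.IsReal} → Circle) :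
    cmLetterBlock L e dV hdV dW hdW ι₁ (fun v => Pi.evalMonoidHom _ v) (torusLetter L e dV hdV dW hdW ι₁ t) = diagHom t := by
  apply Subtype.ext
  rw [cmLetterBlock_apply, coe_placeBlock, coe_diagHom']
  have hR : (Matrix.diagonal fun l : Fin n × {v : InfinitePlace ↥(maximalRealSubfield L) // v.IsReal} => ((t l : Circle) : ℂ)) =
      Matrix.blockDiagonal fun v => Matrix.diagonal fun i => ((t (i, v) : Circle) : ℂ) := by
    rw [Matrix.blockDiagonal_diagonal]
  rw [hR]
  congr 1
  funext v
  have h1 : (Pi.evalMonoidHom _ v) (torusLetter L e dV hdV dW hdW ι₁ t) =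
      ((diagHom fun p : PosIdx (cmXV L dV hdV ι₁ v) =>
          if 0 < cmXW L dV dW hdW ι₁ v 0 then (t (e (p.1, 0), v))⁻¹ else t (e (p.1, 0), v),
        diagHom fun q : NegIdx (cmXV L dV hdV ι₁ v) =>
          if 0 < cmXW L dV dW hdW ι₁ v 0 then t (e (q.1, 0), v) else (t (e (q.1, 0), v))⁻¹),
       (diagHom (fun _ : PosIdx (cmXW L dV dW hdW ι₁ v) => (1 : Circle)),
        diagHom (fun _ : NegIdx (cmXW L dV dW hdW ι₁ v) => (1 : Circle)))) := by
    rw [Pi.evalMonoidHom_apply]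
    refine Prod.ext rfl (Prod.ext ?_ ?_)
    · exact ((map_one (diagHom (σ := PosIdx (cmXW L dV dW hdW ι₁ v)))).symm)
    · exact ((map_one (diagHom (σ := NegIdx (cmXW L dV dW hdW ι₁ v)))).symm)
  rw [h1, dualPairι_diagHom]
  ext i j
  by_cases hij : i = j
  · subst hij
    rw [reindexUnitary_apply, coe_diagHom', Matrix.diagonal_apply_eq, Matrix.diagonal_apply_eq]
    -- the value of `dpTorus` at `pairFrame i`
    have hiV : e.symm i = ((e.symm i).1, 0) := Prod.ext rfl (Subsingleton.elim _ _)
    have hei : e ((e.symm i).1, 0) = i := by rw [← hiV, Equiv.apply_symm_apply]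
    rw [pairFrame, Equiv.trans_apply, Equiv.trans_apply, hiV, Equiv.prodCongr_apply, Prod.map]
    simp only [cmEpsV, cmEpsW, signSplit]
    by_cases hVpos : 0 < cmXV L dV hdV ι₁ v (e.symm i).1 <;> by_cases hWpos : 0 < cmXW L dV dW hdW ι₁ v 0
    · rw [Equiv.sumCompl_symm_apply_of_pos (p := fun j => 0 < cmXV L dV hdV ι₁ v j) (a := (e.symm i).1) hVpos,
        Equiv.sumCompl_symm_apply_of_pos (p := fun j => 0 < cmXW L dV dW hdW ι₁ v j) (a := 0) hWpos]
      simp [dpEquiv, dpTorus, hWpos, hei]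
    · rw [Equiv.sumCompl_symm_apply_of_pos (p := fun j => 0 < cmXV L dV hdV ι₁ v j) (a := (e.symm i).1) hVpos,
        Equiv.sumCompl_symm_apply_of_neg (p := fun j => 0 < cmXW L dV dW hdW ι₁ v j) (a := 0) hWpos]
      simp [dpEquiv, dpTorus, hWpos, hei]
    · rw [Equiv.sumCompl_symm_apply_of_neg (p := fun j => 0 < cmXV L dV hdV ι₁ v j) (a := (e.symm i).1) hVpos,
        Equiv.sumCompl_symm_apply_of_pos (p := fun j => 0 < cmXW L dV dW hdW ι₁ v j) (a := 0) hWpos]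
      simp [dpEquiv, dpTorus, hWpos, hei]
    · rw [Equiv.sumCompl_symm_apply_of_neg (p := fun j => 0 < cmXV L dV hdV ι₁ v j) (a := (e.symm i).1) hVpos,
        Equiv.sumCompl_symm_apply_of_neg (p := fun j => 0 < cmXW L dV dW hdW ι₁ v j) (a := 0) hWpos]
      simp [dpEquiv, dpTorus, hWpos, hei]
  · rw [reindexUnitary_apply, coe_diagHom', Matrix.diagonal_apply_ne _ hij,
      Matrix.diagonal_apply_ne _ fun h => hij ((pairFrame _ _ _ _ e _ _).injective h)]

end TorusLetters

/-! ## § 3. CORE: joint eigenspaces of the torus letters of a line pin are at most one-dimensional -/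

section LineCore

open HodgeCM.Model.HypCensus

variable (L : Type) [Field L] [NumberField L] [IsCMField L] {N n : ℕ} (e : Fin N × Fin 1 ≃ Fin n)
variable (dV : Fin N → L) (hdV : ∀ i, IsCMField.complexConj L (dV i) = dV i) (hdV0 : ∀ i, dV i ≠ 0)
variable (dW : Fin 1 → L) (hdW : ∀ i, IsCMField.complexConj L (dW i) = dW i) (hdW0 : ∀ i, dW i ≠ 0)
variable (hGR : (cmSplittingDatum L e dV hdV hdV0 dW hdW hdW0).CompatibleSplitting) (ι₁ : L →+* ℂ)

set_option maxHeartbeats 400000 in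
/-- **CORE.**  For a LINE pin (`M = 1`) under the four sign facts: two Schwartz functions on `(L⁺ ⊗ ℝ)ⁿ` which are
simultaneous eigenvectors of ALL torus letters `ω_∞(letterSection (torusLetter t))`, `t ∈ (S¹)^{Fin n × places}`, with the
SAME eigenvalue function `c`, are proportional.  (Engine § 1 + `cmLetterBlock_torusLetter` + § 0: in the big frame the torus
letters act by `χ(t) • μ₀(diag t)`, whose joint eigenspaces in `𝓢(ℝ^σ)` are the Hermite lines.) -/
theorem exists_eq_smul_of_torusLetter_eigen
    (h₁V : ∃ i₀ : Fin N, (∀ i, i ≠ i₀ → 0 < (ι₁ (dV i)).re) ∨ ∀ i, i ≠ i₀ → (ι₁ (dV i)).re < 0)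
    (h₁W : (∀ j, 0 < (ι₁ (dW j)).re) ∨ ∀ j, (ι₁ (dW j)).re < 0)
    (hV : ∀ τ : L →+* ℂ, InfinitePlace.mk τ ≠ InfinitePlace.mk ι₁ → (∀ i, 0 < (τ (dV i)).re) ∨ ∀ i, (τ (dV i)).re < 0)
    (hW : ∀ τ : L →+* ℂ, InfinitePlace.mk τ ≠ InfinitePlace.mk ι₁ →
      (∃ j₀ : Fin 1, ∀ j, j ≠ j₀ → 0 < (τ (dW j)).re) ∨ ∀ j, (τ (dW j)).re < 0)
    (c : (Fin n × {v : InfinitePlace ↥(maximalRealSubfield L) // v.IsReal} → Circle) → ℂ)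
    {f g : 𝓢((Fin n → mixedSpace (↥(maximalRealSubfield L))), ℂ)} (hf0 : f ≠ 0)
    (hf : ∀ t, cmArchWeilRep L e dV hdV hdV0 dW hdW hdW0 hGR
      (letterSection L dV hdV hdV0 dW hdW hdW0 ι₁ (torusLetter L e dV hdV dW hdW ι₁ t)) f = c t • f)
    (hg : ∀ t, cmArchWeilRep L e dV hdV hdV0 dW hdW hdW0 hGR
      (letterSection L dV hdV hdV0 dW hdW hdW0 ι₁ (torusLetter L e dV hdV dW hdW ι₁ t)) g = c t • g) :
    ∃ r : ℂ, g = r • f := by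
  obtain ⟨χ, hχ⟩ := exists_character_letterSection_apply L e dV hdV hdV0 dW hdW hdW0 hGR ι₁ h₁V h₁W hV hW
  set 𝔢 := schwartzTransport (cmBigFrame L e dV hdV hdV0 dW hdW hdW0 ι₁) with h𝔢
  have key : ∀ {u : 𝓢((Fin n → mixedSpace (↥(maximalRealSubfield L))), ℂ)},
      (∀ t, cmArchWeilRep L e dV hdV hdV0 dW hdW hdW0 hGR
        (letterSection L dV hdV hdV0 dW hdW hdW0 ι₁ (torusLetter L e dV hdV dW hdW ι₁ t)) u = c t • u) →
      ∀ t, ((χ (torusLetter L e dV hdV dW hdW ι₁ t) : Circle) : ℂ) • unitaryOpPi (diagHom t) (𝔢 u) = c t • 𝔢 u := by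
    intro u hu t
    have h1 := hu t
    rw [hχ, cmLetterBlock_torusLetter] at h1
    have h2 := congrArg 𝔢 h1
    rwa [map_smul, map_smul, h𝔢, ContinuousLinearEquiv.apply_symm_apply] at h2
  have hF0 : 𝔢 f ≠ 0 := fun h0 => hf0 (by simpa using congrArg 𝔢.symm h0)
  obtain ⟨r, hr⟩ := exists_eq_smul_of_torusEigen (fun t => t) Function.surjective_id
    (fun t => ((χ (torusLetter L e dV hdV dW hdW ι₁ t) : Circle) : ℂ)) c (fun t => Circle.coe_ne_zero _) hF0 (key hf) (key hg)
  refine ⟨r, ?_⟩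
  have h3 := congrArg 𝔢.symm hr
  rwa [map_smul, ContinuousLinearEquiv.symm_apply_apply, ContinuousLinearEquiv.symm_apply_apply] at h3

end LineCore

end HodgeCM.Model.MultOne
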